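import Mathlib
import Summits.ResolutionOfSingularities.ResolutionOfSingularities.Theorems.HomologicalConductorPersistenceSurfaceSaturationCommonCompletion
import HarnessLib

/-!
# Rung S-2 `PersistenceSurface` (stmt-ResolutionOfSingularities-19970), stub C1 (`Sat₄`) — the vertex of
# `U = k[u,v]^{(n;1,q)}` has height `2`: `dim U_𝔪 = 2`, and `Sat₆` at every analytically-toric SURFACE stage

[OURS · cell decomp-res · rung S-2; seat leafhand-res-homologicalconduct-15 gen 0]  Nothing here is a statement of the
manuscript under review (Hironaka 2017); AI-written, weaker than expert review.  DEF-FREE.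

`…PersistenceSurfaceSaturationCommonCompletion.cohomologyAnnihilator_le_caAt_of_ringEquiv_completion_vertex` (this
seat, p823280) carries `dim S = d` for the localisation `S` of `U` at the vertex as a hypothesis.  Here `d = 2` is
computed: the chain `0 < (u)·k[u,v] ∩ U < 𝔪` gives `ht 𝔪 ≥ 2`, and `ht 𝔪 ≤ dim U = 2`
(`…CyclicQuotientLocalVertex.ringKrullDim_degreeZero`).

* `isPrime_comap_span_X_zero`, `comap_span_X_zero_ne_bot`, `comap_span_X_zero_lt_vertex` — the height-one prime
  `(u) ∩ U` under the vertex;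
* `height_vertex` — `ht 𝔪 = 2`; `ringKrullDim_atVertex` — `dim S = 2` for every localisation `S` of `U` at `𝔪`;
* `cohomologyAnnihilator_le_caAt_six_of_ringEquiv_completion_vertex` — every noetherian local `T` of dimension `2`
  with `T̂ ≃+* Ŝ` (both completions isolated singularities) has `ca(T) ⊆ ca⁶(T)`.

References: folklore; S. B. Iyengar, R. Takahashi, IMRN 2016 [`IyengarTakahashi2014`] (vocabulary) — tree lemmas only.
-/

-- single-problem summit: the doubled namespace component `ResolutionOfSingularities` is forced
set_option linter.dupNamespace false

noncomputable section

open IsLocalRing MvPolynomial Literature.RingTheory.CohomologyAnnihilator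
open Summit.ResolutionOfSingularities.ResolutionOfSingularities.Theorems.HomologicalConductor.PersistenceCyclicQuotientCharFree
  (isNoetherianRing_degreeZero)
open Summit.ResolutionOfSingularities.ResolutionOfSingularities.Theorems.HomologicalConductor.PersistenceCyclicQuotientLocalVertex
open Summit.ResolutionOfSingularities.ResolutionOfSingularities.Theorems.HomologicalConductor.PersistenceCyclicQuotientVertexIsolated
open Summit.ResolutionOfSingularities.ResolutionOfSingularities.Theorems.HomologicalConductor.PersistenceSurfaceSaturationCommonCompletion

universe u

namespace Summit.ResolutionOfSingularities.ResolutionOfSingularities.Theorems.HomologicalConductor.PersistenceCyclicQuotientVertexDimension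

variable {k : Type u} [Field k] {n : ℕ} [NeZero n] {q : ℕ} (U : Subalgebra k (MvPolynomial (Fin 2) k))
variable (hU : ∀ p, p ∈ U ↔ weightedHomogeneousComponent (![1, (q : ZMod n)] : Fin 2 → ZMod n) 0 p = p)

/-! ## The height-one prime `(u) ∩ U` -/

omit [NeZero n] in
/-- `(u)·k[u,v] ∩ U` is a prime ideal of `U` (`u` is a prime element of `k[u,v]`). [folklore] -/
theorem isPrime_comap_span_X_zero :
    ((Ideal.span {(X 0 : MvPolynomial (Fin 2) k)}).comap U.val.toRingHom).IsPrime := by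
  haveI : (Ideal.span {(X 0 : MvPolynomial (Fin 2) k)}).IsPrime :=
    (Ideal.span_singleton_prime (X_ne_zero 0)).mpr X_prime
  exact Ideal.IsPrime.comap _

include hU in
/-- `(u) ∩ U ≠ 0`: it contains `uⁿ`. [folklore] -/
theorem comap_span_X_zero_ne_bot :
    (Ideal.span {(X 0 : MvPolynomial (Fin 2) k)}).comap U.val.toRingHom ≠ ⊥ := by
  have hnpos : 0 < n := Nat.pos_of_ne_zero (NeZero.ne n)
  intro h
  have hmem : (⟨(X 0 : MvPolynomial (Fin 2) k) ^ n, X_pow_mem U hU 0⟩ : U) ∈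
      (Ideal.span {(X 0 : MvPolynomial (Fin 2) k)}).comap U.val.toRingHom := by
    rw [Ideal.mem_comap]
    change (X 0 : MvPolynomial (Fin 2) k) ^ n ∈ Ideal.span {(X 0 : MvPolynomial (Fin 2) k)}
    exact Ideal.mem_span_singleton.mpr (dvd_pow_self _ hnpos.ne')
  rw [h, Ideal.mem_bot] at hmem
  exact pow_ne_zero n (X_ne_zero (0 : Fin 2)) (congrArg Subtype.val hmem)

include hU in
/-- `(u) ∩ U < 𝔪` for the vertex `𝔪 ∋ uⁿ, vⁿ`: multiples of `u` have zero constant term, hence lie in `𝔪`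
(`…VertexIsolated.mem_of_constantCoeff_eq_zero`); `vⁿ ∈ 𝔪` is not a multiple of `u`. [folklore] -/
theorem comap_span_X_zero_lt_vertex (𝔪 : Ideal U) [𝔪.IsMaximal]
    (hu : (⟨(X 0 : MvPolynomial (Fin 2) k) ^ n, X_pow_mem U hU 0⟩ : U) ∈ 𝔪)
    (hv : (⟨(X 1 : MvPolynomial (Fin 2) k) ^ n, X_pow_mem U hU 1⟩ : U) ∈ 𝔪) :
    (Ideal.span {(X 0 : MvPolynomial (Fin 2) k)}).comap U.val.toRingHom < 𝔪 := by
  refine lt_of_le_of_ne ?_ ?_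
  · intro x hx
    rw [Ideal.mem_comap, Ideal.mem_span_singleton] at hx
    obtain ⟨y, hy⟩ := hx
    refine mem_of_constantCoeff_eq_zero U hU 𝔪 hu hv x ?_
    change constantCoeff (x : MvPolynomial (Fin 2) k) = 0
    have hy' : (x : MvPolynomial (Fin 2) k) = X 0 * y := hy
    rw [hy', map_mul, constantCoeff_X, zero_mul]
  · intro h
    have hvmem : (⟨(X 1 : MvPolynomial (Fin 2) k) ^ n, X_pow_mem U hU 1⟩ : U) ∈
        (Ideal.span {(X 0 : MvPolynomial (Fin 2) k)}).comap U.val.toRingHom := by rw [h]; exact hv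
    rw [Ideal.mem_comap, Ideal.mem_span_singleton] at hvmem
    obtain ⟨y, hy⟩ := hvmem
    have hy' : (X 1 : MvPolynomial (Fin 2) k) ^ n = X 0 * y := hy
    -- evaluate at `u = 0`, `v = 1`
    have h1 := congrArg (MvPolynomial.eval (fun i : Fin 2 => if i = 0 then (0 : k) else 1)) hy'
    simp only [map_pow, map_mul, eval_X, Fin.one_eq_zero_iff, OfNat.ofNat_ne_one, if_false, one_pow, if_true,
      zero_mul] at h1
    exact one_ne_zero h1

/-! ## `ht 𝔪 = 2` and `dim U_𝔪 = 2` -/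

include hU in
/-- **The vertex has height `2`**: `0 < (u) ∩ U < 𝔪` gives `ht 𝔪 ≥ 2`; `ht 𝔪 ≤ dim U = 2`. [folklore] -/
theorem height_vertex (𝔪 : Ideal U) [𝔪.IsMaximal]
    (hu : (⟨(X 0 : MvPolynomial (Fin 2) k) ^ n, X_pow_mem U hU 0⟩ : U) ∈ 𝔪)
    (hv : (⟨(X 1 : MvPolynomial (Fin 2) k) ^ n, X_pow_mem U hU 1⟩ : U) ∈ 𝔪) : 𝔪.height = 2 := by
  haveI := isPrime_comap_span_X_zero U
  set 𝔭 := (Ideal.span {(X 0 : MvPolynomial (Fin 2) k)}).comap U.val.toRingHom with h𝔭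
  -- lower bound
  have h1 : 1 ≤ 𝔭.height := by
    rw [Order.one_le_iff_ne_zero, Ne, Ideal.height_eq_zero_iff_eq_bot]
    exact comap_span_X_zero_ne_bot U hU
  have h2 : 𝔭.height + 1 ≤ 𝔪.height :=
    Ideal.height_add_one_le_of_lt_of_isPrime (comap_span_X_zero_lt_vertex U hU 𝔪 hu hv)
  -- upper bound
  have h3 : (𝔪.height : WithBot ℕ∞) ≤ ringKrullDim U := Ideal.height_le_ringKrullDim_of_isPrime
  rw [ringKrullDim_degreeZero U hU] at h3
  have h3' : 𝔪.height ≤ 2 := by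
    have h3'' : (𝔪.height : WithBot ℕ∞) ≤ ((2 : ℕ∞) : WithBot ℕ∞) := by simpa using h3
    exact WithBot.coe_le_coe.mp h3''
  have h4 : (2 : ℕ∞) ≤ 𝔪.height := by
    calc (2 : ℕ∞) = 1 + 1 := by norm_num
      _ ≤ 𝔭.height + 1 := add_le_add h1 le_rfl
      _ ≤ 𝔪.height := h2
  exact le_antisymm h3' h4

include hU in
/-- **`dim S = 2`** for every localisation `S` of `U` at the vertex (`dim S = ht 𝔪`). [folklore] -/
theorem ringKrullDim_atVertex (𝔪 : Ideal U) [𝔪.IsMaximal]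
    (hu : (⟨(X 0 : MvPolynomial (Fin 2) k) ^ n, X_pow_mem U hU 0⟩ : U) ∈ 𝔪)
    (hv : (⟨(X 1 : MvPolynomial (Fin 2) k) ^ n, X_pow_mem U hU 1⟩ : U) ∈ 𝔪)
    (S : Type u) [CommRing S] [Algebra U S] [IsLocalization.AtPrime S 𝔪] : ringKrullDim S = (2 : ℕ) := by
  rw [IsLocalization.AtPrime.ringKrullDim_eq_height 𝔪 S, height_vertex U hU 𝔪 hu hv]
  norm_cast

/-! ## `Sat₆` at analytically-toric surface stages -/

include hU in
/-- **`ca(T) ⊆ ca⁶(T)` at every noetherian local SURFACE stage analytically isomorphic to the vertex**: `T` noetherian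
local of Krull dimension `2`, `S` a localisation of `U = k[u,v]^{(n;1,q)}` (`gcd(q,n) = 1`, `k` any field) at its
vertex, both completions isolated singularities, `e : T̂ ≃+* Ŝ` ⇒ `ca(T) ⊆ ca⁶(T)` (the shifted transport of
`…SaturationCommonCompletion` with `dim S = 2` computed here).  `Sat₄` at such `T` waits for the level-exact door's
hypothesis (levelled `Sat₄` on `Ŝ`). [OURS · cell decomp-res] -/
theorem cohomologyAnnihilator_le_caAt_six_of_ringEquiv_completion_vertex (hq : q.Coprime n) (𝔪 : Ideal U)
    [𝔪.IsMaximal] (hu : (⟨(X 0 : MvPolynomial (Fin 2) k) ^ n, X_pow_mem U hU 0⟩ : U) ∈ 𝔪)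
    (hv : (⟨(X 1 : MvPolynomial (Fin 2) k) ^ n, X_pow_mem U hU 1⟩ : U) ∈ 𝔪)
    (S : Type u) [CommRing S] [Algebra U S] [IsLocalization.AtPrime S 𝔪] [IsNoetherianRing S] [IsLocalRing S]
    {T : Type u} [CommRing T] [IsNoetherianRing T] [IsLocalRing T] (hdT : ringKrullDim T = (2 : ℕ))
    (hisoS : IsIsolatedSingularity (AdicCompletion (maximalIdeal S) S))
    (hisoT : IsIsolatedSingularity (AdicCompletion (maximalIdeal T) T))
    (e : AdicCompletion (maximalIdeal T) T ≃+* AdicCompletion (maximalIdeal S) S) :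
    cohomologyAnnihilator T ≤ cohomologyAnnihilatorOfDegree T 6 := by
  have hdS : ringKrullDim S = (2 : ℕ) := ringKrullDim_atVertex U hU 𝔪 hu hv S
  have h := cohomologyAnnihilator_le_caAt_of_ringEquiv_completion_vertex U hU hq 𝔪 hu hv S hdS hdT hisoS hisoT e
  exact h

end Summit.ResolutionOfSingularities.ResolutionOfSingularities.Theorems.HomologicalConductor.PersistenceCyclicQuotientVertexDimension

end
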